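import Summits.BirchSwinnertonDyer.BirchSwinnertonDyer.Theorems.PrintCf2DisegniPairTwoChiArchClauseEvaluation
import Summits.BirchSwinnertonDyer.Rank1Residual.AdditivePotMult.TwistPointsOver
import Literature.NumberTheory.EllipticCurves.GrossZagierRationalPoint
import HarnessLib

/-!
# Road (C) `disegni-pair-two` on crux stmt-BirchSwinnertonDyer-20368 — PRELIMINARIES for paying the entry
# ticket `PrintCf2.SplitBadTwoDisegniGZPairOfFacts` (stmt-BirchSwinnertonDyer-27325): the completed square of
# ANY elliptic `W/ℚ` fixes `x`, and (ε) the Rankin–Selberg `L`-function of the pair has a SIMPLE central zero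

Cell `bsd-print-cf2` (`run/shared/lean/pub/bsd-print-cf2/`), width seat `bsd-line-cf2-p1-w8` g25.
`--supports stmt-BirchSwinnertonDyer-20368` (helper). THEOREMS ONLY (no `def`, no named fact, no `sorry`);
the modularity continuation `hasEntireLFunction_rat` is a named-fact HYPOTHESIS where used. BSD is not proved
by any of this; no summit statement is claimed; 20368 is not closed here. Consumer:
`PrintCf2DisegniPairTwoDisegniGZPair.lean` (the item text as a theorem).

## What is proved

* §1 `sq_u_sqChange_and_r_eq_zero` — for EVERY elliptic `W/ℚ` the completed-square change `sqChange W`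
  (`C • W = W^{(1)}`, a `Classical.choose`) has `u² = 1` and `r = 0`: `W` and `W^{(1)}` have the same
  `c₄, c₆, b₂`, so `u⁻⁴c₄ = c₄`, `u⁻⁶c₆ = c₆` force `u⁴ = 1` or `u⁶ = 1` in `ℚ`, i.e. `u² = 1`, and then
  `u⁻²(b₂ + 12r) = b₂` forces `r = 0` (the tree had this for `cm7` only, by solving the equations:
  `sq_u_sqChange_cm7_and_r`). Hence `x_twistPointEquivOver_incl_some'`: the abscissa of the twist
  substitution `Φ_t(ι(X, Y))` (`twistPointEquivOver`, `(X,Y) ↦ (X/t², Y/t³)` then un-completing the square)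
  is `t⁻²·X` for every `V` — the input of the PIN `isCanonicalCyc_pairing_eq_minusTwist` (`x = X/d`).
* §2 `simpleZero_rankinSelberg_of_pair` — (ε): EVERY entire continuation `Λ` of
  `rankinSelbergEulerProductHecke f (ψ∘N_{K/ℚ})` from `re s > 2` has `Λ(1) = 0 ≠ Λ′(1)`, when `f` is a
  newform, `W = V ⊗ ψ` (coefficientwise newform `g = f ⊗ ψ`) has analytic rank `1` and `W′` (newform
  `g′ = f′ ⊗ ψ`, `a_n(f′) = κ_K(n)a_n(f)`) has `L(W′,1) ≠ 0`: Artin formalism (tree THEOREM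
  `rankinSelbergEulerProductHecke_baseChangeDirichlet_eq_holds`, Gross 2004 §13) + modularity continuation
  (`entireLFunction_eq_twistedLSeries`) say `L(W,·)·L(W′,·)` is such a continuation; identity theorem;
  `L(W,1) = 0`, `L′(W,1) ≠ 0` (`entireLFunction_one_eq_zero_of_analyticRank_eq_one`,
  `leadingLCoeff_eq_deriv_of_analyticRank_eq_one`). This is the hypothesis «`L(s, σ_{A,E} ⊗ χ)` has a simple
  zero at the centre» (⇒ `ε = −1`) of Disegni's Theorem B in the tree's currency
  (`thmB_chi_quadraticBaseChange`).

References: B. Gross, MSRI Publ. 49 (2004) §3, §13 [Gross2004]; C. Breuil, B. Conrad, F. Diamond, R. Taylor,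
JAMS 14 (2001) Thm. A [BreuilConradDiamondTaylor2001]; J. Silverman, AEC (2009) III.1, X.5 Cor. 5.4
[SilvermanAEC2009]; D. Disegni, Compos. Math. 153 (2017) Thm. B [Disegni2017].
-/

set_option autoImplicit false
set_option linter.dupNamespace false

noncomputable section

open scoped Classical MatrixGroups ModularForm NumberField

open CongruenceSubgroup NumberField IsDedekindDomain WeierstrassCurve Literature.NumberTheory.EllipticCurves
  Literature.NumberTheory.EllipticCurves.ModularForms
  Literature.NumberTheory.EllipticCurves.Disegni2017 Literature.NumberTheory.GaloisRepresentations
  Summit.BirchSwinnertonDyer.Rank1Residual.AdditivePotMult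

namespace Summit.BirchSwinnertonDyer.BirchSwinnertonDyer.Theorems.PrintCf2.DisegniPairTwo

/-! ### §1 The completed square of ANY elliptic `W/ℚ` fixes `x`; the abscissa of the twist substitution -/

section SqChange

/-- **`sqChange W` has `u² = 1` and `r = 0` for every elliptic `W/ℚ`.** `C • W = W^{(1)}` with
`W^{(1)} = [0, b₂/4, 0, b₄/2, b₆/4]` having the same `b₂`, `c₄`, `c₆` as `W`; so `u⁻⁴c₄ = c₄` and
`u⁻⁶c₆ = c₆` (Mathlib `variableChange_c₄/c₆`), and `Δ ≠ 0` gives `c₄ ≠ 0` or `c₆ ≠ 0`, whence `(u²)² = 1` or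
`(u²)³ = 1` with `u² > 0` in `ℚ`, i.e. `u² = 1`; then `u⁻²(b₂ + 12r) = b₂` (`variableChange_b₂`) gives `r = 0`.
[cite: SilvermanAEC2009, III.1 Table 3.1 (change-of-variables formulae)] -/
theorem sq_u_sqChange_and_r_eq_zero (W : WeierstrassCurve ℚ) [W.IsElliptic] :
    ((sqChange W).u : ℚ) ^ 2 = 1 ∧ (sqChange W).r = 0 := by
  set C := sqChange W with hCdef
  have hC : C • W = W.quadraticTwist 1 := sqChange_spec W
  have hc4 : (C • W).c₄ = W.c₄ := by rw [hC, quadraticTwist_c₄, one_pow, one_mul]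
  have hc6 : (C • W).c₆ = W.c₆ := by rw [hC, quadraticTwist_c₆, one_pow, one_mul]
  have hb2 : (C • W).b₂ = W.b₂ := by rw [hC, quadraticTwist_b₂, one_mul]
  rw [variableChange_c₄] at hc4
  rw [variableChange_c₆] at hc6
  rw [variableChange_b₂] at hb2
  set w : ℚ := ((C.u⁻¹ : ℚˣ) : ℚ) with hw
  have hΔ : W.Δ ≠ 0 := W.isUnit_Δ.ne_zero
  have hrel := W.c_relation
  -- `v := w² > 0` satisfies `v² = 1` or `v³ = 1`
  have hv0 : 0 ≤ w ^ 2 := sq_nonneg w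
  have hv1 : w ^ 2 = 1 := by
    by_cases h4 : W.c₄ = 0
    · have h6 : W.c₆ ≠ 0 := by
        intro h6
        apply hΔ
        have h0 : (1728 : ℚ) * W.Δ = 0 := by rw [hrel, h4, h6]; norm_num
        simpa using h0
      have h3 : w ^ 6 = 1 := mul_right_cancel₀ h6 (by rw [one_mul]; exact hc6)
      have h3' : (w ^ 2) ^ 3 = 1 := by rw [← pow_mul]; exact h3
      exact (pow_eq_one_iff_of_nonneg hv0 (by norm_num)).mp h3'
    · have h2 : w ^ 4 = 1 := mul_right_cancel₀ h4 (by rw [one_mul]; exact hc4)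
      have h2' : (w ^ 2) ^ 2 = 1 := by rw [← pow_mul]; exact h2
      exact (pow_eq_one_iff_of_nonneg hv0 (by norm_num)).mp h2'
  refine ⟨?_, ?_⟩
  · -- `u² = (w²)⁻¹ = 1`
    have : ((C.u : ℚˣ) : ℚ) = w⁻¹ := by rw [hw, Units.val_inv_eq_inv_val, inv_inv]
    rw [this, inv_pow, hv1, inv_one]
  · -- `b₂ + 12 r = b₂`
    rw [hv1, one_mul] at hb2
    linarith

variable (V : WeierstrassCurve ℚ) [V.IsElliptic] {A : Type} [Field A] [CharZero A] {t : A} {c : ℚ}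
  (ht : t ∉ Set.range (algebraMap ℚ A)) (htc : t ^ 2 = algebraMap ℚ A c)

/-- **The abscissa of the twist substitution, any elliptic `V/ℚ`.** For a field `A ⊇ ℚ`, `t ∈ A ∖ ℚ` with
`t² = c`, and an affine point `(X, Y)` of `V^{(c)}(ℚ)`: `Φ_t(ι(X, Y))` (`twistPointEquivOver`) is the affine
point of `V(A)` with `x`-coordinate `t⁻² · X` (step one `(X,Y) ↦ (X/t², Y/t³)` onto `V^{(1)}`, then
un-completing the square by `(sqChange V)⁻¹`, which fixes `x` by `sq_u_sqChange_and_r_eq_zero`). The tree's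
`x_twistPointEquivOver_incl_some` is the case `V = cm7`. [cite: SilvermanAEC2009, X.5 Cor. 5.4 and III.1] -/
theorem x_twistPointEquivOver_incl_some' {X Y : ℚ} (h : (V.quadraticTwist c).toAffine.Nonsingular X Y) :
    ∃ yQ hQ, twistPointEquivOver V ht htc (QuadraticDescent.incl A (V.quadraticTwist c) (.some X Y h)) =
      .some (t⁻¹ ^ 2 * algebraMap ℚ A X) yQ hQ := by
  set P := QuadraticDescent.incl A (V.quadraticTwist c) (.some X Y h) with hP
  have hPsome : P = .some (algebraMap ℚ A X) (algebraMap ℚ A Y)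
      ((Affine.baseChange_nonsingular (W := V.quadraticTwist c) (f := Algebra.ofId ℚ A)
        (algebraMap ℚ A).injective X Y).mpr h) := by
    rw [hP]; rfl
  set Q := twistPointEquivOver V ht htc P with hQ
  have hQP : twistStepTwo V (A := A) Q = twistStepOne V ht htc P := by
    rw [hQ, twistPointEquivOver_apply, AddEquiv.apply_symm_apply]
  rcases hQc : Q with _ | ⟨xQ, yQ, hQ'⟩
  · exfalso
    rw [hQc, hPsome, twistStepOne_some, ← Affine.Point.zero_def, map_zero] at hQP
    exact Affine.Point.some_ne_zero _ hQP.symm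
  · rw [hQc, hPsome, twistStepTwo_some, twistStepOne_some] at hQP
    have hx := ((Affine.Point.some.injEq _ _ _ _ _ _).mp hQP).1
    obtain ⟨hu2, hr0⟩ := sq_u_sqChange_and_r_eq_zero V
    have huA : ((((sqChange V).map (algebraMap ℚ A)).u⁻¹ : Aˣ) : A) ^ 2 = 1 := by
      rw [Units.val_inv_eq_inv_val, inv_pow]
      simp only [VariableChange.map, Units.coe_map, MonoidHom.coe_coe]
      rw [← map_pow, hu2, map_one, inv_one]
    have hx' : xQ = t⁻¹ ^ 2 * algebraMap ℚ A X := by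
      rw [VariableChange.toX_def, (toX_toY_twistUntwist ht (algebraMap ℚ A X) (algebraMap ℚ A Y)).1, huA,
        one_mul] at hx
      simpa [VariableChange.map, hr0] using hx
    subst hx'
    exact ⟨yQ, hQ', rfl⟩

end SqChange

/-! ### §2 (ε): the Rankin–Selberg `L`-function on the `ψ∘N`-line has a SIMPLE zero at the centre -/

section SimpleZero

variable (K : Type) [Field K] [NumberField K] [IsGalois ℚ K]

/-- **(ε) Simple central zero of `L(s, σ_{V,K} ⊗ ψ∘N)` for the road-(C) pair.** `K` quadratic with
Kronecker character `κ` (both the odd-prime values and the value at `2`), `f` a newform, `f′` with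
`a_n(f′) = κ(n)a_n(f)`, `ψ` primitive mod `m` with `(m, d_K) = 1`, `W`, `W′/ℚ` elliptic with newforms
`g = f ⊗ ψ`, `g′ = f′ ⊗ ψ` (coefficientwise), `ord_{s=1} L(W,s) = 1`, `L(W′,1) ≠ 0`, modularity
continuations. Then EVERY entire `Λ` with `Λ(s) = rankinSelbergEulerProductHecke f (ψ∘N) s` on `re s > 2`
has `Λ(1) = 0` and `Λ′(1) ≠ 0`: by Artin formalism and the identity theorem `Λ = L(W,·)·L(W′,·)`, so
`Λ(1) = L(W,1)L(W′,1) = 0` and `Λ′(1) = L′(W,1)L(W′,1) ≠ 0`.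
[cite: Gross2004, §3 (p. 40), §13 (p. 49)] [cite: BreuilConradDiamondTaylor2001, Thm. A] -/
theorem simpleZero_rankinSelberg_of_pair (hmod : hasEntireLFunction_rat) (h2 : Module.finrank ℚ K = 2)
    (κ : DirichletCharacter ℂ (NumberField.discr K).natAbs)
    (hκ : ∀ ℓ : ℕ, ℓ.Prime → ℓ ≠ 2 → κ ℓ = (jacobiSym (NumberField.discr K) ℓ : ℂ))
    (hκ2 : κ 2 = if NumberField.discr K % 8 = 1 then 1
        else if NumberField.discr K % 8 = 5 then -1 else 0)
    {N N' M M' : ℕ} [NeZero N] [NeZero N'] [NeZero M] [NeZero M']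
    {f : CuspForm (Gamma0 N) 2} {f' : CuspForm (Gamma0 N') 2}
    {g : CuspForm (Gamma0 M) 2} {g' : CuspForm (Gamma0 M') 2}
    (hf : IsNewform0 f) (hV' : ∀ n : ℕ, cuspCoeff f' n = κ (n : ZMod _) * cuspCoeff f n)
    {m : ℕ} [NeZero m] {ψ : DirichletCharacter ℂ m} (hψ : ψ.IsPrimitive)
    (hcop : Nat.Coprime m (NumberField.discr K).natAbs)
    (W W' : WeierstrassCurve ℚ) [W.IsElliptic] [W'.IsElliptic]
    (hg : IsNewformOf W g) (hg' : IsNewformOf W' g')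
    (hgψ : ∀ k : ℕ, cuspCoeff g k = ψ k * cuspCoeff f k)
    (hg'ψ : ∀ k : ℕ, cuspCoeff g' k = ψ k * cuspCoeff f' k)
    (hW1 : W.analyticRank = 1) (hL' : W'.entireLFunction 1 ≠ 0) :
    ∀ Λ : ℂ → ℂ, Differentiable ℂ Λ →
      (∀ s : ℂ, 2 < s.re → Λ s = rankinSelbergEulerProductHecke f (baseChangeDirichlet K ψ) s) →
        Λ 1 = 0 ∧ deriv Λ 1 ≠ 0 := by
  haveI : NeZero (NumberField.discr K).natAbs :=
    ⟨Int.natAbs_ne_zero.mpr (NumberField.discr_ne_zero K)⟩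
  intro Λ hΛ hΛeq
  have hW := W.differentiable_entireLFunction (hmod W)
  have hW' := W'.differentiable_entireLFunction (hmod W')
  -- Artin formalism + modularity: on `re s > 2` the Euler product is `L(W,s)·L(W′,s)`
  have hprod : ∀ s : ℂ, 2 < s.re → rankinSelbergEulerProductHecke f (baseChangeDirichlet K ψ) s =
      W.entireLFunction s * W'.entireLFunction s := by
    intro s hs
    rw [entireLFunction_eq_twistedLSeries hmod W hg ψ hgψ hs,
      entireLFunction_eq_twistedLSeries hmod W' hg' ψ hg'ψ hs,
      ← twistedLSeries_mul_eq_of_coeff_kronecker' κ hV' ψ s, baseChangeDirichlet_def]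
    exact rankinSelbergEulerProductHecke_baseChangeDirichlet_eq_holds K h2 κ hκ hκ2 f hf ψ hψ hcop s hs
  -- identity theorem: `Λ = L(W,·)·L(W′,·)` everywhere
  have heq : Λ = fun s => W.entireLFunction s * W'.entireLFunction s := by
    refine AnalyticOnNhd.eq_of_eventuallyEq (z₀ := (3 : ℂ))
      (hΛ.differentiableOn.analyticOnNhd isOpen_univ)
      ((hW.mul hW').differentiableOn.analyticOnNhd isOpen_univ) ?_
    have hopen : IsOpen {s : ℂ | (2 : ℝ) < s.re} := isOpen_lt continuous_const Complex.continuous_re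
    filter_upwards [hopen.mem_nhds (show (2 : ℝ) < (3 : ℂ).re by norm_num)] with s hs
    rw [hΛeq s hs, hprod s hs]
  have h1 : W.entireLFunction 1 = 0 := entireLFunction_one_eq_zero_of_analyticRank_eq_one hW1
  have hd1 : deriv W.entireLFunction 1 ≠ 0 := (leadingLCoeff_eq_deriv_of_analyticRank_eq_one hW1).2
  subst heq
  refine ⟨by simp only [h1, zero_mul], ?_⟩
  rw [show (fun s => W.entireLFunction s * W'.entireLFunction s) = W.entireLFunction * W'.entireLFunction
      from rfl, deriv_mul (hW 1) (hW' 1), h1, zero_mul, add_zero]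
  exact mul_ne_zero hd1 hL'

end SimpleZero

end Summit.BirchSwinnertonDyer.BirchSwinnertonDyer.Theorems.PrintCf2.DisegniPairTwo

end
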